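import Literature.Computability.Complexity.ThresholdGadgets
import Literature.Computability.Complexity.SmallPrimesCRT
import HarnessLib

/-!
# Residues of a selected product modulo small primes, and the CRT quotient, in constant depth

The threshold LAYERS of the Chinese-remainder algorithm for iterated multiplication
(`ITMULT ≤cd MAJ`: Vollmer 1999, §1.4.2, Thm. 1.40; Beame–Cook–Hoover 1986; Chandra–Stockmeyer–
Vishkin 1984), built from the gadgets of `ThresholdGadgets.lean` and the arithmetic of
`SmallPrimesCRT.lean`, in the realizability calculus `ACRealOver` / `ACVecOver` over `tcBasis`:

* `prodSel A₀ A y = A₀ · ∏_{y f = 1} A_f` — the **selected product** of hard-wired naturals along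
  Boolean selectors `y : F → Bool` (both multiple products in the evaluation of the Naor–Reingold
  functions have this shape: `a₀ ∏_{xᵢ=1} aᵢ`, and a product of preprocessed powers of `g`
  selected by one-hot codes; Naor–Reingold 2004, §4.2);
* `acRealOver_prodSel_mod` — for a prime `p ≤ L` the residue test `[prodSel A₀ A y mod p = r]` is
  realized at depth `6` with `resBitSize (card F) L` gates: a multiplexer of the zero test
  `[∃ f, y f ∧ p ∣ A_f]` (one threshold gate) and a predicate of the weighted sum of DISCRETE
  LOGARITHMS `∑_{y f} dlog(A_f mod p)` (weights `< p`; Vollmer's eq. (1.5)–(1.6));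
* `residueLayer` — over a set `S` of primes `≤ L`, ONE layer of depth `6` whose wires
  `(p, ρ)` carry the one-hot residue code `[prodSel mod p = ρ]` (`oneHotWires (resSel …)`);
* `crtLayer` — on top of it (depth `9`), the one-hot code of the small weighted sum
  `∑_{p ∈ S} ũ_p(prodSel mod p)` of truncated CRT fractions (`SmallPrimes.apxU`), from which the
  CRT quotient `κ` is `(· + |S|) / 2^b` (`SmallPrimes.crtK_eq_approx`; `crtK_prodSel_eq`), the
  residue wires being passed through — so that the next multiple product can be SELECTED by these
  wires without ever writing the reconstructed number in binary (Naor–Reingold 2004, §4.2.1,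
  p. 252: "computing values `rᵢ` (obtained by the CRT-representation) for which `y = ∑ mᵢ rᵢ` …
  is just as good").

Also: binary/ternary `∧`, `∨` and the multiplexer over any basis `B ⊇ acBasis`
(`ACRealOver.and₂`, `or₂`, `and₃`, `ite`). Everything is proved.

## References

* H. Vollmer, *Introduction to Circuit Complexity* (1999), §1.4.2, proof of Thm. 1.40.
* P. Beame, S. Cook, H. J. Hoover, *Log depth circuits for division and related problems*,
  SIAM J. Comput. 15 (1986) 994–1003.
* M. Naor, O. Reingold, *Number-theoretic constructions of efficient pseudo-random functions*,
  J. ACM 51 (2004), §4.2, §4.2.1 (p. 252), Thm. 4.5.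
-/

namespace Literature.Computability.Complexity

open Finset

variable {ι : Type*}

/-! ### Binary connectives and the multiplexer over a basis containing `acBasis` -/

namespace ACRealOver

variable {B : Set GateFn} {f g h : (ι → Bool) → Bool} {d s t u : ℕ}

/-- Binary `∧` of two realizations of equal depth over `B ⊇ acBasis`: depth `+ 1`, sizes add
`+ 1`. [cite: Vollmer1999, §1.2] -/
theorem and₂ (hB : acBasis ⊆ B) (hf : ACRealOver B f d s) (hg : ACRealOver B g d t) :
    ACRealOver B (fun x => f x && g x) (d + 1) (s + t + 1) := by
  have h := acRealOver_forall hB (M := 2) (f := ![f, g]) (s := ![s, t])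
    (fun j => by fin_cases j <;> simpa)
  refine (h.congr fun x => ?_).mono le_rfl (by simp [Fin.sum_univ_two])
  simp [Fin.forall_fin_two]

/-- Binary `∨` over `B ⊇ acBasis`: depth `+ 1`, sizes add `+ 1`. [cite: Vollmer1999, §1.2] -/
theorem or₂ (hB : acBasis ⊆ B) (hf : ACRealOver B f d s) (hg : ACRealOver B g d t) :
    ACRealOver B (fun x => f x || g x) (d + 1) (s + t + 1) := by
  have h := acRealOver_exists hB (M := 2) (f := ![f, g]) (s := ![s, t])
    (fun j => by fin_cases j <;> simpa)
  refine (h.congr fun x => ?_).mono le_rfl (by simp [Fin.sum_univ_two])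
  simp [Fin.exists_fin_two]

/-- Ternary `∧` over `B ⊇ acBasis`: depth `+ 1`, sizes add `+ 1`. [cite: Vollmer1999, §1.2] -/
theorem and₃ (hB : acBasis ⊆ B) (hf : ACRealOver B f d s) (hg : ACRealOver B g d t)
    (hh : ACRealOver B h d u) :
    ACRealOver B (fun x => f x && g x && h x) (d + 1) (s + t + u + 1) := by
  have h := acRealOver_forall hB (M := 3) (f := ![f, g, h]) (s := ![s, t, u])
    (fun j => by fin_cases j <;> simpa)
  refine (h.congr fun x => ?_).mono le_rfl (by simp [Fin.sum_univ_three, add_assoc])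
  simp [Fin.forall_fin_succ, Bool.and_assoc]

/-- **Multiplexer** `if c then f else g = (c ∧ f) ∨ (¬c ∧ g)` over `B ⊇ acBasis`, all three
realized at depth `d`: depth `+ 2` (the negation is free). [cite: Vollmer1999, §1.2] -/
theorem ite (hB : acBasis ⊆ B) {c : (ι → Bool) → Bool} {sc : ℕ} (hc : ACRealOver B c d sc)
    (hf : ACRealOver B f d s) (hg : ACRealOver B g d t) :
    ACRealOver B (fun x => if c x = true then f x else g x) (d + 2) (2 * sc + s + t + 4) := by
  have hnot : GateFn.not ∈ B := hB mem_acBasis_not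
  have h1 : ACRealOver B (fun x => c x && f x) (d + 1) (sc + s + 1) := and₂ hB hc hf
  have h2 : ACRealOver B (fun x => !c x && g x) (d + 1) (sc + 1 + t + 1) :=
    and₂ hB (hc.neg hnot) hg
  refine ((or₂ hB h1 h2).congr fun x => ?_).mono le_rfl (by omega)
  cases c x <;> simp

end ACRealOver

/-! ### Selected products -/

variable {F : Type*} [Fintype F]

/-- The **selected product** `Π(y) = A₀ · ∏_{f : y f = 1} A_f` of hard-wired naturals along a
Boolean selector vector. [cite: NaorReingold2004, §4.2 (p. 251: "one multiple product … y = a₀ · ∏_{xᵢ=1} aᵢ")] -/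
def prodSel (A₀ : ℕ) (A : F → ℕ) (y : F → Bool) : ℕ := A₀ * ∏ f, if y f = true then A f else 1

/-- A selected product with `A₀ < 2^W` and factors `< 2^W` is `< 2^{W (card F + 1)}`. [folklore] -/
theorem prodSel_lt_two_pow {A₀ : ℕ} {A : F → ℕ} {W : ℕ} (h₀ : A₀ < 2 ^ W) (hA : ∀ f, A f < 2 ^ W)
    (y : F → Bool) : prodSel A₀ A y < 2 ^ (W * (Fintype.card F + 1)) := by
  unfold prodSel
  have h1 : ∏ f, (if y f = true then A f else 1) ≤ ∏ _f : F, 2 ^ W :=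
    Finset.prod_le_prod' fun f _ => by
      split
      · exact (hA f).le
      · exact Nat.one_le_two_pow
  rw [Finset.prod_const, card_univ] at h1
  calc A₀ * ∏ f, (if y f = true then A f else 1) ≤ A₀ * (2 ^ W) ^ Fintype.card F :=
        Nat.mul_le_mul_left _ h1
    _ < 2 ^ W * (2 ^ W) ^ Fintype.card F := Nat.mul_lt_mul_of_pos_right h₀ (by positivity)
    _ = 2 ^ (W * (Fintype.card F + 1)) := by rw [← pow_succ', ← pow_mul, Nat.mul_comm]

/-- A selected factor divisible by `p` makes the selected product divisible by `p`. [folklore] -/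
theorem dvd_prodSel_of_sel {p A₀ : ℕ} {A : F → ℕ} {y : F → Bool} {f : F} (hf : y f = true)
    (hp : p ∣ A f) : p ∣ prodSel A₀ A y := by
  unfold prodSel
  refine Dvd.dvd.mul_left (hp.trans ?_) _
  have := Finset.dvd_prod_of_mem (fun f => if y f = true then A f else 1) (mem_univ f)
  simpa [hf] using this

/-- **Products become sums of logarithms** (Vollmer's eq. (1.5)): if no selected factor vanishes
modulo `p` then `Π(y) ≡ A₀ · γ^{∑_{y f = 1} dlog(A_f)} (mod p)`. [cite: Vollmer1999, §1.4.2, proof of Thm. 1.40, eq. (1.5)] -/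
theorem prodSel_cast_eq {p : ℕ} (D : SmallPrimes.DlogData p) (A₀ : ℕ) (A : F → ℕ) (y : F → Bool)
    (hy : ∀ f, y f = true → ((A f : ℕ) : ZMod p) ≠ 0) :
    ((prodSel A₀ A y : ℕ) : ZMod p) =
      (A₀ : ZMod p) * D.γ ^ wsum (fun f => D.dlog (A f : ZMod p)) y := by
  unfold prodSel wsum
  rw [Nat.cast_mul, Nat.cast_prod, ← Finset.prod_pow_eq_pow_sum]
  congr 1
  refine Finset.prod_congr rfl fun f _ => ?_
  by_cases hf : y f = true
  · rw [if_pos hf, hf, Bool.toNat_true, mul_one, D.pow_dlog _ (hy f hf)]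
  · rw [if_neg hf, Bool.eq_false_iff.2 hf, Bool.toNat_false, mul_zero, Nat.cast_one, pow_zero]

/-! ### The residue test as a Boolean function of the selectors -/

/-- The zero test `[∃ f, y f = 1 ∧ p ∣ A_f]`, written as the threshold `[1 ≤ #such f]`. [folklore] -/
def zeroSel (p : ℕ) (A : F → ℕ) (y : F → Bool) : Bool :=
  decide (1 ≤ wsum (fun f => if p ∣ A f then 1 else 0) y)

/-- The zero test fires iff some selected factor is divisible by `p`. [folklore] -/
theorem zeroSel_eq_true_iff (p : ℕ) (A : F → ℕ) (y : F → Bool) :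
    zeroSel p A y = true ↔ ∃ f, y f = true ∧ p ∣ A f := by
  unfold zeroSel wsum
  rw [decide_eq_true_eq, Nat.one_le_iff_ne_zero, Ne, Finset.sum_eq_zero_iff]
  push Not
  constructor
  · rintro ⟨f, -, hf⟩
    by_cases hy : y f = true
    · by_cases hd : p ∣ A f
      · exact ⟨f, hy, hd⟩
      · simp [hd] at hf
    · simp [hy] at hf
  · rintro ⟨f, hy, hd⟩
    exact ⟨f, mem_univ f, by simp [hy, hd]⟩

/-- The residue test `[Π(y) mod p = r]` computed from the selectors: if some selected factor is
divisible by `p` the residue is `0`, otherwise it is read off the weighted sum of logarithms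
(Vollmer's eqs. (1.5)–(1.6), "the particular case that one of the `aᵢ mod p_j` is equal to `0`
can easily be taken care of"). [cite: Vollmer1999, §1.4.2, proof of Thm. 1.40, eqs. (1.5)–(1.6)] -/
def resBit (p : ℕ) (D : SmallPrimes.DlogData p) (A₀ : ℕ) (A : F → ℕ) (r : ℕ) (y : F → Bool) :
    Bool :=
  if zeroSel p A y = true then decide (r = 0)
  else decide (((A₀ : ZMod p) * D.γ ^ wsum (fun f => D.dlog (A f : ZMod p)) y).val = r)

/-- **Correctness of the residue test** (for every modulus; if `p ∣ A₀` both sides test `r = 0`). [cite: Vollmer1999, §1.4.2, proof of Thm. 1.40, eqs. (1.5)–(1.6)] -/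
theorem resBit_eq {p : ℕ} (D : SmallPrimes.DlogData p) (A₀ : ℕ) (A : F → ℕ) (r : ℕ)
    (y : F → Bool) : resBit p D A₀ A r y = decide (prodSel A₀ A y % p = r) := by
  unfold resBit
  split
  · rename_i hz
    obtain ⟨f, hf, hd⟩ := (zeroSel_eq_true_iff p A y).1 hz
    have h0 : prodSel A₀ A y % p = 0 := Nat.mod_eq_zero_of_dvd (dvd_prodSel_of_sel hf hd)
    rw [h0, decide_eq_decide]
    exact ⟨fun h => h.symm, fun h => h.symm⟩
  · rename_i hz
    have hy : ∀ f, y f = true → ((A f : ℕ) : ZMod p) ≠ 0 := by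
      intro f hf h0
      rw [ZMod.natCast_eq_zero_iff] at h0
      exact hz ((zeroSel_eq_true_iff p A y).2 ⟨f, hf, h0⟩)
    rw [← prodSel_cast_eq D A₀ A y hy, ZMod.val_natCast]

/-! ### Realization of one residue test -/

/-- Size of one residue-test block for `c` selectors and primes `≤ L`. [folklore] -/
def resBitSize (c L : ℕ) : ℕ := 4 * c + 14 + (c * L + 1) * (8 * (c * L) + 15)

/-- `resBitSize` is monotone. [folklore] -/
theorem resBitSize_mono {c c' L L' : ℕ} (hc : c ≤ c') (hL : L ≤ L') :
    resBitSize c L ≤ resBitSize c' L' := by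
  unfold resBitSize
  have := Nat.mul_le_mul hc hL
  gcongr

/-- **One residue test in depth `6`**: for a prime `p ≤ L`, `y ↦ [Π(y) mod p = r]` is realized
over `tcBasis` at depth `6` with `resBitSize (card F) L` gates — a multiplexer of the zero test (a
threshold, depth `2`), a constant, and a predicate of the weighted sum of logarithms (depth `4`,
weights `< p ≤ L`). [cite: Vollmer1999, §1.4.2, proof of Thm. 1.40] -/
theorem acRealOver_prodSel_mod {p L : ℕ} (hp : p.Prime) (hpL : p ≤ L) (A₀ : ℕ) (A : F → ℕ)
    (r : ℕ) :
    ACRealOver tcBasis (fun y : F → Bool => decide (prodSel A₀ A y % p = r)) 6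
      (resBitSize (Fintype.card F) L) := by
  haveI : Fact p.Prime := ⟨hp⟩
  obtain ⟨D⟩ := SmallPrimes.exists_dlogData p
  -- the three ingredients, all lifted to depth 4
  have hc : ACRealOver tcBasis (zeroSel p A) 4 (2 * Fintype.card F + 4) := by
    have h := acRealOver_wsum_ge (α := F) (fun f => if p ∣ A f then 1 else 0) 1
    refine (h.congr fun y => rfl).mono (by omega) ?_
    have : (∑ f : F, if p ∣ A f then 1 else 0) ≤ Fintype.card F := by
      calc (∑ f : F, if p ∣ A f then 1 else 0) ≤ ∑ _f : F, 1 :=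
            Finset.sum_le_sum fun f _ => by split <;> omega
        _ = Fintype.card F := by simp
    omega
  have hf : ACRealOver tcBasis (fun _ : F → Bool => decide (r = 0)) 4 1 :=
    (acRealOver_const acBasis_subset_tcBasis _).mono (by omega) le_rfl
  have hR : (∑ f, D.dlog (A f : ZMod p)) < Fintype.card F * L + 1 := by
    rw [Nat.lt_succ_iff]
    calc (∑ f, D.dlog (A f : ZMod p)) ≤ ∑ _f : F, L :=
          Finset.sum_le_sum fun f _ => ((D.dlog_lt _).le.trans hpL)
      _ = Fintype.card F * L := by simp
  have hg : ACRealOver tcBasis (fun y : F → Bool =>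
      decide (((A₀ : ZMod p) * D.γ ^ wsum (fun f => D.dlog (A f : ZMod p)) y).val = r)) 4
      ((Fintype.card F * L + 1) * (8 * (Fintype.card F * L) + 15) + 1) := by
    have h := acRealOver_wsum_pred (α := F) (fun f => D.dlog (A f : ZMod p)) hR
      (fun s => ((A₀ : ZMod p) * D.γ ^ s).val = r)
    refine (h.congr fun y => rfl).mono le_rfl ?_
    have : 4 * ((∑ f, D.dlog (A f : ZMod p)) + (Fintype.card F * L + 1)) + 11 ≤
        8 * (Fintype.card F * L) + 15 := by omega
    exact Nat.succ_le_succ (Nat.mul_le_mul_left _ this)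
  have h := ACRealOver.ite acBasis_subset_tcBasis hc hf hg
  refine (h.congr fun y => ?_).mono le_rfl (by unfold resBitSize; omega)
  rw [← resBit_eq D A₀ A r y]
  rfl

/-! ### The residue layer over a set of small primes -/

/-- The residue selector of the layer: for `p ∈ S`, the residue `Π(y) mod p` as an element of
`Fin (L + 1)` (reduced once more modulo `L + 1`, which is the identity for `p ≤ L`; this keeps
the definition total). [folklore] -/
def resSel (A₀ : ℕ) (A : F → ℕ) (S : Finset ℕ) (L : ℕ) (y : F → Bool) (p : ↥S) : Fin (L + 1) :=
  ⟨prodSel A₀ A y % (p : ℕ) % (L + 1), Nat.mod_lt _ (Nat.succ_pos L)⟩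

/-- For a prime `p ≤ L` the selector is the residue. [folklore] -/
theorem resSel_val {A₀ : ℕ} {A : F → ℕ} {S : Finset ℕ} {L : ℕ} (y : F → Bool) (p : ↥S)
    (hp : (p : ℕ).Prime) (hpL : (p : ℕ) ≤ L) :
    ((resSel A₀ A S L y p : Fin (L + 1)) : ℕ) = prodSel A₀ A y % (p : ℕ) := by
  unfold resSel
  exact Nat.mod_eq_of_lt (Nat.lt_succ_of_le ((Nat.mod_lt _ hp.pos).le.trans hpL))

/-- Size of the residue layer: `|S| (L + 1)` residue-test blocks. [folklore] -/
def residueLayerSize (c cardS L : ℕ) : ℕ := cardS * (L + 1) * resBitSize c L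

/-- `residueLayerSize` is monotone. [folklore] -/
theorem residueLayerSize_mono {c c' k k' L L' : ℕ} (hc : c ≤ c') (hk : k ≤ k') (hL : L ≤ L') :
    residueLayerSize c k L ≤ residueLayerSize c' k' L' := by
  unfold residueLayerSize
  exact Nat.mul_le_mul (Nat.mul_le_mul hk (Nat.succ_le_succ hL)) (resBitSize_mono hc hL)

/-- **The residue layer** (the first layer of `ITMULT ≤cd MAJ`, Vollmer 1999, Thm. 1.40): for a
set `S` of primes `≤ L`, ONE gate list over `tcBasis` of depth `6` and size
`residueLayerSize (card F) |S| L` reads the selectors `y` and outputs on wire `(p, ρ)`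
(`p ∈ S`, `ρ ≤ L`) the bit `[Π(y) mod p = ρ]` — the one-hot coded residue vector of the selected
product. [cite: Vollmer1999, §1.4.2, Thm. 1.40] -/
theorem residueLayer (A₀ : ℕ) (A : F → ℕ) {S : Finset ℕ} (hS : ∀ p ∈ S, p.Prime) {L : ℕ}
    (hSL : ∀ p ∈ S, p ≤ L) :
    ACVecOver tcBasis (oneHotWires (resSel A₀ A S L)) 6
      (residueLayerSize (Fintype.card F) S.card L) := by
  have h := acVecOver_ofBlocks_fintype_const (B := tcBasis) (κ := ↥S × Fin (L + 1))
    (f := fun q y => decide (prodSel A₀ A y % (q.1 : ℕ) = (q.2 : ℕ)))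
    (fun q => acRealOver_prodSel_mod (hS q.1 q.1.2) (hSL q.1 q.1.2) A₀ A q.2)
  refine (h.congr fun y q => ?_).mono le_rfl ?_
  · rw [oneHotWires_apply, decide_eq_decide, Fin.ext_iff, resSel_val y q.1 (hS q.1 q.1.2)
      (hSL q.1 q.1.2)]
  · unfold residueLayerSize
    rw [Fintype.card_prod, Fintype.card_coe, Fintype.card_fin]

/-! ### The CRT quotient read off the residue wires -/

/-- The weights of the quotient computation: wire `(p, ρ)` weighs the truncated fraction
`ũ_p(ρ) = ⌊crtT S p ρ · 2^b / M⌋`. [folklore] -/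
def quotWt (S : Finset ℕ) (L : ℕ) (q : ↥S × Fin (L + 1)) : ℕ := SmallPrimes.apxU S q.1 q.2

/-- On the residue wires the quotient weights sum to `∑_{p ∈ S} ũ_p(Π(y) mod p)`. [folklore] -/
theorem wsum_quotWt {A₀ : ℕ} {A : F → ℕ} {S : Finset ℕ} (hS : ∀ p ∈ S, p.Prime) {L : ℕ}
    (hSL : ∀ p ∈ S, p ≤ L) (y : F → Bool) :
    wsum (quotWt S L) (oneHotWires (resSel A₀ A S L) y) =
      ∑ p ∈ S, SmallPrimes.apxU S p (prodSel A₀ A y % p) := by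
  rw [wsum_oneHotWires, ← Finset.sum_coe_sort S]
  refine Finset.sum_congr rfl fun p _ => ?_
  unfold quotWt
  rw [resSel_val y p (hS p p.2) (hSL p p.2)]

/-- The total quotient weight is `< quotRange |S|`, a polynomial range:
`quotRange k = k (L' …)` — we use `∑ ũ < |S| · 2^b ≤ |S| (4|S| + 1)`. [folklore] -/
def quotRange (cardS : ℕ) : ℕ := cardS * (4 * cardS + 1) + 1

/-- `quotRange` is monotone. [folklore] -/
theorem quotRange_mono {k k' : ℕ} (hk : k ≤ k') : quotRange k ≤ quotRange k' := by
  unfold quotRange; gcongr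

/-- The quotient weights are small: total `< quotRange |S|` (but we only need the bound on the
value of the weighted sum on one-hot inputs, and the total over ALL wires for the size). The total
over all wires is `≤ |S| (L + 1) (4|S| + 1)`. [folklore] -/
theorem sum_quotWt_le {S : Finset ℕ} (hS : ∀ p ∈ S, p.Prime) (L : ℕ) :
    (∑ q : ↥S × Fin (L + 1), quotWt S L q) ≤ S.card * (L + 1) * (4 * S.card + 1) := by
  calc (∑ q : ↥S × Fin (L + 1), quotWt S L q) ≤ ∑ _q : ↥S × Fin (L + 1), (4 * S.card + 1) :=
        Finset.sum_le_sum fun q _ =>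
          ((SmallPrimes.apxU_lt S hS q.1 q.2).le.trans (SmallPrimes.two_pow_apxB_le S))
    _ = S.card * (L + 1) * (4 * S.card + 1) := by
        rw [Finset.sum_const, card_univ, Fintype.card_prod, Fintype.card_coe, Fintype.card_fin,
          smul_eq_mul]

/-- On one-hot residue wires the quotient sum is `< quotRange |S|`. [folklore] -/
theorem wsum_quotWt_lt {A₀ : ℕ} {A : F → ℕ} {S : Finset ℕ} (hS : ∀ p ∈ S, p.Prime) {L : ℕ}
    (hSL : ∀ p ∈ S, p ≤ L) (y : F → Bool) :
    wsum (quotWt S L) (oneHotWires (resSel A₀ A S L) y) < quotRange S.card := by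
  rw [wsum_quotWt hS hSL, quotRange, Nat.lt_succ_iff]
  calc (∑ p ∈ S, SmallPrimes.apxU S p (prodSel A₀ A y % p)) ≤ ∑ _p ∈ S, (4 * S.card + 1) :=
        Finset.sum_le_sum fun p _ =>
          ((SmallPrimes.apxU_lt S hS p _).le.trans (SmallPrimes.two_pow_apxB_le S))
    _ = S.card * (4 * S.card + 1) := by rw [Finset.sum_const, smul_eq_mul]

/-- **The CRT quotient of the selected product from the residue wires**: if `4 Π(y) < M` then
`κ = crtK S (Π y) = (∑ wires quotWt · wire + |S|) / 2^b`. [cite: NaorReingold2004, §4.2.1 (p. 252)] -/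
theorem crtK_prodSel_eq {A₀ : ℕ} {A : F → ℕ} {S : Finset ℕ} (hS : ∀ p ∈ S, p.Prime) {L : ℕ}
    (hSL : ∀ p ∈ S, p ≤ L) (y : F → Bool) (h4 : 4 * prodSel A₀ A y < SmallPrimes.crtM S) :
    SmallPrimes.crtK S (prodSel A₀ A y) =
      (wsum (quotWt S L) (oneHotWires (resSel A₀ A S L) y) + S.card) / 2 ^ SmallPrimes.apxB S := by
  rw [wsum_quotWt hS hSL, SmallPrimes.crtK_eq_approx S hS h4]

/-- The wires after the CRT layer: the one-hot code of the quotient sum (`Sum.inl v`,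
`v < quotRange |S|`) followed by the residue wires (`Sum.inr (p, ρ)`). [folklore] -/
def crtWires (A₀ : ℕ) (A : F → ℕ) (S : Finset ℕ) (L : ℕ) (y : F → Bool) :
    Fin (quotRange S.card) ⊕ ↥S × Fin (L + 1) → Bool :=
  Sum.elim (fun v => decide (wsum (quotWt S L) (oneHotWires (resSel A₀ A S L) y) = (v : ℕ)))
    (oneHotWires (resSel A₀ A S L) y)

/-- Size of the CRT layer. [folklore] -/
def crtLayerSize (c cardS L : ℕ) : ℕ :=
  quotRange cardS * (4 * (cardS * (L + 1) * (4 * cardS + 1) + quotRange cardS) + 11) +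
    residueLayerSize c cardS L

/-- `crtLayerSize` is monotone. [folklore] -/
theorem crtLayerSize_mono {c c' k k' L L' : ℕ} (hc : c ≤ c') (hk : k ≤ k') (hL : L ≤ L') :
    crtLayerSize c k L ≤ crtLayerSize c' k' L' := by
  unfold crtLayerSize
  have h1 := quotRange_mono hk
  have h2 := residueLayerSize_mono hc hk hL
  gcongr

/-- **The CRT layer**: residues of the selected product modulo the primes of `S` (one-hot, passed
through) and the one-hot code of the quotient sum, in depth `9` and size
`crtLayerSize (card F) |S| L`. [cite: Vollmer1999, §1.4.2, Thm. 1.40] -/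
theorem crtLayer (A₀ : ℕ) (A : F → ℕ) {S : Finset ℕ} (hS : ∀ p ∈ S, p.Prime) {L : ℕ}
    (hSL : ∀ p ∈ S, p ≤ L) :
    ACVecOver tcBasis (crtWires A₀ A S L) 9 (crtLayerSize (Fintype.card F) S.card L) := by
  have hres := residueLayer A₀ A hS hSL
  have hq := (acVecOver_wsum_oneHot (α := ↥S × Fin (L + 1)) (quotWt S L)
    (quotRange S.card)).keepInputs
  have h := hq.comp hres
  refine (h.congr fun y w => ?_).mono le_rfl ?_
  · cases w <;> rfl
  · unfold crtLayerSize
    have := sum_quotWt_le hS L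
    gcongr

end Literature.Computability.Complexity
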